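import Summits.QuantumFields.YangMills.Theorems.BalabanUVNodesPortS1JacDomLocal

/-!
# NODE O port PT-A — `stub_LZjacDom`, PART 1b: `det A₁^ℂ(c)(W)` (COMPONENT block `jacBlockCt`, trace-projected coordinates) IS WITHIN `r³∕2` OF `r³ = (N_c∕|I|)³` under the polydisc
# condition AT `c` ONLY; slit plane; the window-local Jacobian factor `jacFactorCt c = log det` is ℂ-ANALYTIC there (ROW (a)) and `|jacFactorCt c W − log r³| ≤ 1` (ROW (b))

Cell `ym-nodeO-ideate`, porter seat `ymgap-nodeO-port-PTA-1` (gen 7, lead of the line `pta-residueW` of 27930's skeleton); `--supports stmt-QuantumFields-27930` (helper).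
[I] = [Balaban1987RG1], [15] = [Balaban1985Variational].  Companion of `…JacDomLocal` (§1 coordinate lemmas, §2 the component normal form ★★ `fderiv_avgMh_apply_single_centralBond_eq`).
WHY.  PTZ-1's rows (✓p814103 `…JacobianHoloDomainDet`) are stated for gen 5's Pi-form block `jacBlockC` and carry the polydisc hypothesis at EVERY coarse bond; the line's formula objects
use the COMPONENT block `jacBlockCt` (✓p814190), which reads the window of `c` only.  THIS FILE re-runs PTZ-1's (C) §6 for the component block with the component normal form: the algebra,
the (0.8) estimate (`norm_centralResponseC_sub_le`), the `3 × 3` perturbation bound (`norm_det_sub_cube_le`), the slit-plane and logarithm steps are PTZ-1's, consumed by name; the analytic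
layer is gen 5's `contDiffAt_jacBlockC_apply` road (second derivative of the `C^ω` component map `B15AveragingHolomorphicLocalAnalytic.analyticAt_avgMh_apply`, analytic `Ring.inverse`,
`Complex.log` off the slit).  The determinant hypothesis stays GLOBAL (`∀ b, det W b = 1`): the tower file (PART 2) feeds the spliced field `W on the window, 1 elsewhere`.
* §3 ★★★ `norm_det_jacBlockCt_sub_le` (`‖det A₁^ℂ(c)(W) − r³‖ ≤ r³∕2`), ★★ `det_jacBlockCt_mem_slitPlane`.
* §4 `contDiffAt_jacBlockCt_apply`, `contDiffAt_det_jacBlockCt`, ★★ `analyticAt_jacFactorCt`, ★★★ `analyticAt_jacFactorCt_of_loopSmall` (ROW (a), component edition), ★★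
  `norm_jacFactorCt_sub_log_le` (ROW (b), component edition).

HONEST FRAMING.  Kernel calculus ∕ algebra over the tree's own holomorphic (0.4) model, PTZ-1's landed one-step estimate and dag-n07-w2's (0.8) estimate; NOTHING of Bałaban's renormalization-group
estimates asserted, ported or discharged; `stub_LZjacDom` is closed in PART 2∕3 (tower assembly), `stub_LZdet` BLOCKED-ON P0 (α)+(β), `stub_FE` XXL; 27930 ⁸-Ax-LR4 OPEN · no claim; K0⁷∕K-Ax
OPEN; NODE O 0∕1; COUNT 8∕28 · K 1∕4 UNMOVED; finite `𝕋⁴_{L^K}` at fixed ε — NOT continuum ∕ OS ∕ Clay; **the Yang–Mills mass gap is NOT proved by any of this.**  No `sorry`, no `def`, no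
`instance`, no `notation`; standard axioms.
-/

noncomputable section

open scoped BigOperators Matrix.Norms.L2Operator Topology

namespace Summit.QuantumFields.YangMills.Theorems.BalabanUVNodesPortS1

open Summit.QuantumFields.YangMills.Theorems.K0RecordFormatNames
open Literature.MathematicalPhysics.QuantumFieldTheory.Balaban1983to89
open Literature.MathematicalPhysics.QuantumFieldTheory.Balaban1983to89.Node00
open Literature.MathematicalPhysics.QuantumFieldTheory.Balaban1983to89.T4Continuum
  (T4Family LStep walk walkEnd Letter)
open Literature.MathematicalPhysics.QuantumFieldTheory.Balaban1983to89.BlockAveraging (Idx off)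
open Literature.MathematicalPhysics.QuantumFieldTheory.Balaban1983to89.BlockAveragingHaarAC (centralBond IsCentral nCentral openWord)
open Literature.MathematicalPhysics.QuantumFieldTheory.Balaban1983to89.ExpMeanLog (eml eml_eq_exp differentiableAt_eml analyticAt_eml)
open Literature.MathematicalPhysics.QuantumFieldTheory.Balaban1983to89.BlockAveragingPlaquetteBound (norm_eml_sub_one_le_six_mul)
open Literature.MathematicalPhysics.QuantumFieldTheory.Balaban1983to89.B15AveragingHolomorphic
open Literature.MathematicalPhysics.QuantumFieldTheory.Balaban1983to89.B15AveragingHolomorphicLocalAnalytic (analyticAt_avgMh_apply)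
open _root_.Matrix _root_.Filter

variable {P : Params} {j : ℕ}

/-! ## §3  ★★★ `det A₁^ℂ(c)(W)` (component block, trace-projected coordinates) is within `r³∕2` of `r³ = (N_c∕|I|)³` — polydisc condition at `c` only -/

/-- ★★★ **`det A₁^ℂ(c)(W)` IS WITHIN `r³∕2` OF ITS FLAT VALUE `r³`, `r = N_c∕|I|`, COMPONENT EDITION**: for every `SL(2,ℂ)`-valued bond-matrix field `W` whose (0.4) loop matrices AT `c` lie in
the `1∕3`-polydisc and within `α` of `1` at the non-central indices of `c`, provided `646·α ≤ r∕8` (`α ≤ 1∕24`).  PTZ-1's `norm_det_jacBlockC_sub_le` (✓p814103) with the component normal form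
of §2: `A₁^ℂ(c)(W) = N·Ad^ℂ(pre)`, `det Ad^ℂ(pre) = 1`, `N_{ib}` within `646α` of `r·δ_{ib}`, then the `3 × 3` perturbation bound.
[cite: Balaban1987RG1, p.267 («h(c)»), (0.8) p.253, (1.18) p.263; Balaban1985Variational, Prop. 9 p.309] -/
theorem norm_det_jacBlockCt_sub_le (hj : j + 1 ≤ P.m + P.K) (W : PBond P j → MatA 2) (hW : ∀ b, (W b).det = 1) (c : PBond P (j + 1))
    (hpoly : ∀ i : Idx P, ‖loopMh W c i - 1‖ < 1 / 3)
    {α : ℝ} (hα0 : 0 ≤ α) (hα : α ≤ 1 / 24) (hloop : ∀ i, ¬ IsCentral c i → ‖loopMh W c i - 1‖ ≤ α)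
    (hαr : 646 * α ≤ (nCentral c : ℝ) / (Fintype.card (Idx P) : ℝ) / 8) :
    ‖(jacBlockCt c W).det - (((nCentral c : ℝ) / (Fintype.card (Idx P) : ℝ) : ℝ) : ℂ) ^ 3‖ ≤
      ((nCentral c : ℝ) / (Fintype.card (Idx P) : ℝ)) ^ 3 / 2 := by
  classical
  haveI := nonempty_idxP (P := P)
  set r : ℝ := (nCentral c : ℝ) / (Fintype.card (Idx P) : ℝ) with hr
  have hcardpos : (0 : ℝ) < Fintype.card (Idx P) := by exact_mod_cast Fintype.card_pos
  have hr0 : 0 < r := div_pos (by exact_mod_cast BlockAveragingHaarAC.nCentral_pos c) hcardpos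
  have hr1 : r ≤ 1 := by
    rw [hr, div_le_one hcardpos]
    exact_mod_cast (Finset.card_filter_le _ _).trans (Finset.card_univ (α := Idx P)).le
  have hrC : ((r : ℝ) : ℂ) = (nCentral c : ℂ) / (Fintype.card (Idx P) : ℂ) := by rw [hr]; push_cast; rfl
  set β := centralBond c with hβ
  set pre := holMh W (walk (emb c.src) (List.replicate ((P.L - 1) / 2) (c.dir, true))) with hpre
  set F₀ : Idx P → MatA 2 := fun i => loopMh W c i with hF₀
  set E := eml F₀ with hE
  set A := axialMh W c with hA
  set D := fderiv ℂ (eml : (Idx P → MatA 2) → MatA 2) F₀ with hD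
  set H : MatA 2 → Idx P → MatA 2 := fun Y i => if IsCentral c i then 0 else -(F₀ i * Y) with hH
  set T : Fin 3 → MatA 2 := fun b => D (H (su2Gen b)) + E * su2Gen b with hT
  have hpoly1 : ∀ i : Idx P, ‖loopMh W c i - 1‖ < 1 := fun i => (hpoly i).trans (by norm_num)
  have hdpre : pre.det = 1 := det_holMh_eq_one W hW _
  have hdA : A.det = 1 := det_holMh_eq_one W hW _
  -- the loop family: central ones are `1`, all are within `α` and within `1∕3`
  have hFα : ∀ i, ‖F₀ i - 1‖ ≤ α := fun i => by
    by_cases hc : IsCentral c i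
    · simp only [hF₀, loopMh_of_isCentral W hW c i hc, sub_self, norm_zero]; exact hα0
    · exact hloop i hc
  have hdE : E.det = 1 := by
    refine ExpMeanLog.det_eml_eq_one (fun i => det_holMh_eq_one W hW _) (fun i => (hpoly i).le) fun i => ?_
    have h3 := hpoly i
    rw [Fintype.card_fin]
    have hπ : (3 : ℝ) < Real.pi := Real.pi_gt_three
    push_cast
    linarith
  have hE1 : ‖E - 1‖ ≤ 6 * α := norm_eml_sub_one_le_six_mul hFα (hα.trans (by norm_num))
  have hadjE1 : ‖E.adjugate - 1‖ ≤ 18 * α := (norm_adjugate_sub_one_le E).trans (by linarith)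
  have hadjE : ‖E.adjugate‖ ≤ 2 := by
    have h := norm_add_le (E.adjugate - 1) (1 : MatA 2)
    rw [sub_add_cancel, norm_one] at h
    linarith [hα]
  -- (1) the inverse of the average through adjugates
  have havg : avgMh W c = E * A := rfl
  have hinv : (avgMh W c)⁻¹ = A.adjugate * E.adjugate := by
    refine Matrix.inv_eq_left_inv ?_
    rw [havg, ← Matrix.adjugate_mul_distrib, Matrix.adjugate_mul, Matrix.det_mul, hdE, hdA, mul_one, one_smul]
  -- (2) the entries `T_b` are within `314α` of `r·su2Gen b`, hence `N_{ib}` within `646α` of `r δ`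
  have hTb : ∀ b, ‖T b - (r : ℂ) • su2Gen b‖ ≤ 314 * α := fun b => by
    have h := norm_centralResponseC_sub_le (IsCentral c) F₀ (fun i hc => loopMh_of_isCentral W hW c i hc) hα0 hα hloop (su2Gen b)
    rw [norm_su2Gen, mul_one] at h
    have e : D (H (su2Gen b)) + E * su2Gen b - su2Gen b + (((Finset.univ.filter fun i : Idx P => ¬ IsCentral c i).card : ℂ) / (Fintype.card (Idx P) : ℂ)) • su2Gen b =
        T b - (r : ℂ) • su2Gen b := by
      rw [hrC, ← one_sub_nonCentral_div_eq c, sub_smul, one_smul]; simp only [hT]; abel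
    rw [← e]; exact h
  have hN : ∀ i b, ‖su2CoordCt (T b * E.adjugate) i - (if i = b then (r : ℂ) else 0)‖ ≤ 646 * α := fun i b => by
    have hδ : (if i = b then ((r : ℝ) : ℂ) else 0) = su2CoordCt ((r : ℂ) • su2Gen b) i := by
      rw [su2CoordCt_smul, su2CoordCt_su2Gen, mul_ite, mul_one, mul_zero]
    rw [hδ, ← su2CoordCt_sub]
    refine (norm_su2CoordCt_le _ i).trans ?_
    have e : T b * E.adjugate - (r : ℂ) • su2Gen b = (T b - (r : ℂ) • su2Gen b) * E.adjugate + (r : ℂ) • (su2Gen b * (E.adjugate - 1)) := by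
      rw [sub_mul, Matrix.smul_mul, mul_sub, mul_one, smul_sub]; abel
    rw [e]
    calc _ ≤ ‖(T b - (r : ℂ) • su2Gen b) * E.adjugate‖ + ‖(r : ℂ) • (su2Gen b * (E.adjugate - 1))‖ := norm_add_le _ _
      _ ≤ 314 * α * 2 + r * (1 * (18 * α)) := by
          refine add_le_add ((norm_mul_le _ _).trans (mul_le_mul (hTb b) hadjE (norm_nonneg _) (by positivity))) ?_
          rw [norm_smul, Complex.norm_real, Real.norm_of_nonneg hr0.le]
          exact mul_le_mul_of_nonneg_left ((norm_mul_le _ _).trans (by rw [norm_su2Gen]; exact mul_le_mul_of_nonneg_left hadjE1 zero_le_one)) hr0.le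
      _ ≤ 646 * α := by nlinarith
  -- (3) the block is `N · Ad^ℂ(pre)`
  set N : Matrix (Fin 3) (Fin 3) ℂ := Matrix.of fun i b => su2CoordCt (T b * E.adjugate) i with hNdef
  set Ad : Matrix (Fin 3) (Fin 3) ℂ := Matrix.of fun b a => su2CoordC (pre * su2Gen a * pre.adjugate) b with hAd
  have hlin : ∀ z : Fin 3 → ℂ, D (H (∑ b, z b • su2Gen b)) + E * ∑ b, z b • su2Gen b = ∑ b, z b • T b := by
    intro z
    simp only [hT, smul_add, Finset.sum_add_distrib, Matrix.mul_sum, mul_smul_comm]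
    congr 1
    rw [show H (∑ b, z b • su2Gen b) = ∑ b, z b • H (su2Gen b) from responseDir_sum_smul (IsCentral c) F₀ z fun b => su2Gen b,
      map_sum]
    exact Finset.sum_congr rfl fun b _ => by rw [map_smul]
  have hblock : jacBlockCt c W = N * Ad := by
    ext i a
    have htr : (pre * su2Gen a * pre.adjugate).trace = 0 := by
      rw [Matrix.trace_mul_cycle, adjugate_mul_self_of_det_eq_one hdpre, one_mul]; exact trace_su2Gen a
    have hXt : pre * su2Gen a * pre.adjugate = ∑ b, Ad b a • su2Gen b := by
      rw [← sum_su2CoordC_smul_su2Gen htr]; rfl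
    have hresp := fderiv_avgMh_apply_single_centralBond_eq hj W hW c hpoly1 (trace_su2Gen a)
    rw [jacBlockCt, Matrix.of_apply, Matrix.mul_apply, hresp, hinv]
    have e : (D (fun i => if IsCentral c i then 0 else -(loopMh W c i * (pre * su2Gen a * pre.adjugate))) * A +
          E * (pre * su2Gen a * pre.adjugate * A)) * (A.adjugate * E.adjugate) =
        (∑ b, Ad b a • T b) * E.adjugate := by
      rw [← hlin, ← hXt]
      calc _ = (D (H (pre * su2Gen a * pre.adjugate)) + E * (pre * su2Gen a * pre.adjugate)) * (A * A.adjugate) * E.adjugate := by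
              simp only [hH, hF₀]; noncomm_ring
        _ = _ := by rw [self_mul_adjugate_of_det_eq_one hdA, mul_one]
    rw [e, Finset.sum_mul, show (∑ b, Ad b a • T b * E.adjugate) = ∑ b, Ad b a • (T b * E.adjugate) from
      Finset.sum_congr rfl fun b _ => Matrix.smul_mul _ _ _, su2CoordCt_sum_smul]
    refine Finset.sum_congr rfl fun b _ => ?_
    simp only [hNdef, Matrix.of_apply]
    ring
  have hdetAd : Ad.det = 1 := det_adMatC_of_det_eq_one hdpre
  have hdet : (jacBlockCt c W).det = N.det := by rw [hblock, Matrix.det_mul, hdetAd, mul_one]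
  -- (4) the `3 × 3` perturbation bound
  rw [hdet]
  have he0 : (0 : ℝ) ≤ 646 * α := by positivity
  have hper := norm_det_sub_cube_le N hr0.le he0 (fun i b => by simp only [hNdef, Matrix.of_apply]; exact hN i b)
  refine hper.trans ?_
  have he : 646 * α ≤ r / 8 := hαr
  nlinarith [mul_le_mul_of_nonneg_left he (by positivity : (0:ℝ) ≤ r ^ 2),
    mul_le_mul he he he0 (by positivity), pow_le_pow_left₀ he0 he 3, hr0.le, sq_nonneg r]

/-- ★★ **… hence `det A₁^ℂ(c)(W)` (component block) lies in the slit plane** (its real part is at least `r³∕2 > 0`). [cite: Balaban1987RG1, (1.18) p.263, p.268] -/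
theorem det_jacBlockCt_mem_slitPlane (hj : j + 1 ≤ P.m + P.K) (W : PBond P j → MatA 2) (hW : ∀ b, (W b).det = 1) (c : PBond P (j + 1))
    (hpoly : ∀ i : Idx P, ‖loopMh W c i - 1‖ < 1 / 3)
    {α : ℝ} (hα0 : 0 ≤ α) (hα : α ≤ 1 / 24) (hloop : ∀ i, ¬ IsCentral c i → ‖loopMh W c i - 1‖ ≤ α)
    (hαr : 646 * α ≤ (nCentral c : ℝ) / (Fintype.card (Idx P) : ℝ) / 8) :
    (jacBlockCt c W).det ∈ Complex.slitPlane := by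
  haveI := nonempty_idxP (P := P)
  set r : ℝ := (nCentral c : ℝ) / (Fintype.card (Idx P) : ℝ) with hr
  have hr0 : 0 < r := div_pos (by exact_mod_cast BlockAveragingHaarAC.nCentral_pos c) (by exact_mod_cast Fintype.card_pos)
  have h := norm_det_jacBlockCt_sub_le hj W hW c hpoly hα0 hα hloop hαr
  rw [Complex.mem_slitPlane_iff]
  left
  have hre : ((r : ℂ) ^ 3 - (jacBlockCt c W).det).re ≤ ‖(jacBlockCt c W).det - (r : ℂ) ^ 3‖ := by
    rw [← norm_neg, neg_sub]; exact Complex.re_le_norm _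
  have h3 : ((r : ℂ) ^ 3).re = r ^ 3 := by rw [← Complex.ofReal_pow, Complex.ofReal_re]
  rw [Complex.sub_re, h3] at hre
  have hr3 : 0 < r ^ 3 := pow_pos hr0 3
  linarith

/-! ## §4  Smoothness and analyticity of the component block and its Jacobian factor; ROWS (a)(b), component edition -/

/-- **THE ENTRIES OF THE COMPONENT BLOCK `A₁^ℂ(c)(·)` ARE `C^ω` OVER ℂ** at every field whose loop matrices AT `c` lie in the polydisc and whose average at `c` is invertible: the second
derivative of the `C^ω` component map (`B15AveragingHolomorphicLocalAnalytic.analyticAt_avgMh_apply`) applied to a linear direction field, times the analytic `Ring.inverse`, read in the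
projected coordinates (gen 5's `contDiffAt_jacBlockC_apply`, component edition). [cite: Balaban1987RG1, (0.4) p.253 («analytic function»), p.267; Balaban1985Variational, Prop. 9 p.309] -/
theorem contDiffAt_jacBlockCt_apply {W₀ : PBond P j → MatA 2} (c : PBond P (j + 1)) (h : ∀ i : Idx P, ‖loopMh W₀ c i - 1‖ < 1)
    (hU : IsUnit (avgMh W₀ c)) (i a : Fin 3) :
    ContDiffAt ℂ ⊤ (fun W : PBond P j → MatA 2 => jacBlockCt c W i a) W₀ := by
  have hmodel : ContDiffAt ℂ ⊤ (fun W : PBond P j → MatA 2 => avgMh W c) W₀ := (analyticAt_avgMh_apply c h).contDiffAt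
  have hf : ContDiffAt ℂ ⊤ (fun W => fderiv ℂ (fun W' : PBond P j → MatA 2 => avgMh W' c) W) W₀ :=
    hmodel.fderiv_right (m := ⊤) le_top
  have hv : ContDiff ℂ ⊤ (fun W : PBond P j → MatA 2 => (Pi.single (centralBond c) (su2Gen a * W (centralBond c)) : PBond P j → MatA 2)) := by
    refine contDiff_pi.2 fun b => ?_
    by_cases hb : b = centralBond c
    · subst hb
      simp only [Pi.single_eq_same]
      exact contDiff_const.mul (contDiff_apply ℂ (MatA 2) _)
    · simp only [Pi.single_eq_of_ne hb]
      exact contDiff_const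
  have happ : ContDiffAt ℂ ⊤ (fun W => fderiv ℂ (fun W' : PBond P j → MatA 2 => avgMh W' c) W
      (Pi.single (centralBond c) (su2Gen a * W (centralBond c)))) W₀ := hf.clm_apply hv.contDiffAt
  obtain ⟨u, hu⟩ := hU
  have hinv : ContDiffAt ℂ ⊤ (fun W : PBond P j → MatA 2 => (avgMh W c)⁻¹) W₀ := by
    have e : (fun W : PBond P j → MatA 2 => (avgMh W c)⁻¹) = fun W => Ring.inverse (avgMh W c) :=
      funext fun W => Matrix.nonsing_inv_eq_ringInverse _
    rw [e]
    have hri : ContDiffAt ℂ ⊤ (Ring.inverse : MatA 2 → MatA 2) (avgMh W₀ c) := by rw [← hu]; exact contDiffAt_ringInverse ℂ u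
    exact hri.comp W₀ hmodel
  show ContDiffAt ℂ ⊤ (fun W : PBond P j → MatA 2 => su2CoordCt (fderiv ℂ (fun W' : PBond P j → MatA 2 => avgMh W' c) W
      (Pi.single (centralBond c) (su2Gen a * W (centralBond c))) * (avgMh W c)⁻¹) i) W₀
  exact (contDiff_su2CoordCt i).contDiffAt.comp W₀ (happ.mul hinv)

/-- **`det A₁^ℂ(c)(·)` (component block) IS `C^ω` OVER ℂ** (a polynomial in the nine `C^ω` entries). [cite: Balaban1987RG1, p.268, (1.18) p.263] -/
theorem contDiffAt_det_jacBlockCt {W₀ : PBond P j → MatA 2} (c : PBond P (j + 1)) (h : ∀ i : Idx P, ‖loopMh W₀ c i - 1‖ < 1)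
    (hU : IsUnit (avgMh W₀ c)) :
    ContDiffAt ℂ ⊤ (fun W : PBond P j → MatA 2 => (jacBlockCt c W).det) W₀ := by
  have he : ∀ i a : Fin 3, ContDiffAt ℂ ⊤ (fun W : PBond P j → MatA 2 => jacBlockCt c W i a) W₀ := fun i a => contDiffAt_jacBlockCt_apply c h hU i a
  simp only [Matrix.det_fin_three]
  exact ((((((he 0 0).mul (he 1 1)).mul (he 2 2)).sub (((he 0 0).mul (he 1 2)).mul (he 2 1))).sub (((he 0 1).mul (he 1 0)).mul (he 2 2))).add
    (((he 0 1).mul (he 1 2)).mul (he 2 0))).add (((he 0 2).mul (he 1 0)).mul (he 2 1)) |>.sub (((he 0 2).mul (he 1 1)).mul (he 2 0))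

/-- ★★ **THE WINDOW-LOCAL JACOBIAN FACTOR IS ANALYTIC** at every field with loop matrices at `c` in the polydisc, invertible average at `c`, and `det A₁^ℂ(c)` off the closed negative real axis.
[cite: Balaban1987RG1, (1.18) p.263 («analytic functions on the spaces (1.11)–(1.16)»), p.268] -/
theorem analyticAt_jacFactorCt {W₀ : PBond P j → MatA 2} (c : PBond P (j + 1)) (h : ∀ i : Idx P, ‖loopMh W₀ c i - 1‖ < 1)
    (hU : IsUnit (avgMh W₀ c)) (hslit : (jacBlockCt c W₀).det ∈ Complex.slitPlane) :
    AnalyticAt ℂ (jacFactorCt c : (PBond P j → MatA 2) → ℂ) W₀ := by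
  show AnalyticAt ℂ (fun W : PBond P j → MatA 2 => Complex.log (jacBlockCt c W).det) W₀
  exact ((contDiffAt_det_jacBlockCt c h hU).analyticAt).clog hslit

/-- ★★★ **ROW (a), COMPONENT EDITION, ON THE LOOP-SMALL `SL(2,ℂ)` DOMAIN AT `c`**: the window-local Jacobian factor `jacFactorCt c = log det A₁^ℂ(c)(·)` is ℂ-ANALYTIC at every `SL(2,ℂ)`-valued
field whose (0.4) loop matrices AT `c` lie in the `1∕3`-polydisc and within `α` of `1` at the non-central indices of `c`, `646·α ≤ (N_c∕|I|)∕8` — nothing is asked at the other coarse bonds.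
[cite: Balaban1987RG1, (1.18) p.263, p.267–268; Balaban1985Variational, Prop. 9 p.309] -/
theorem analyticAt_jacFactorCt_of_loopSmall (hj : j + 1 ≤ P.m + P.K) (W : PBond P j → MatA 2) (hW : ∀ b, (W b).det = 1) (c : PBond P (j + 1))
    (hpoly : ∀ i : Idx P, ‖loopMh W c i - 1‖ < 1 / 3)
    {α : ℝ} (hα0 : 0 ≤ α) (hα : α ≤ 1 / 24) (hloop : ∀ i, ¬ IsCentral c i → ‖loopMh W c i - 1‖ ≤ α)
    (hαr : 646 * α ≤ (nCentral c : ℝ) / (Fintype.card (Idx P) : ℝ) / 8) :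
    AnalyticAt ℂ (jacFactorCt c : (PBond P j → MatA 2) → ℂ) W :=
  analyticAt_jacFactorCt c (fun i => (hpoly i).trans (by norm_num)) (isUnit_avgMh_of_det_eq_one W hW c hpoly)
    (det_jacBlockCt_mem_slitPlane hj W hW c hpoly hα0 hα hloop hαr)

/-- ★★ **ROW (b), COMPONENT EDITION: THE JACOBIAN FACTOR IS WITHIN `1` OF `log r³`** on the same domain: `‖jacFactorCt c W − log((N_c∕|I|)³)‖ ≤ 1` (`det = r³(1 + w)`, `|w| ≤ ½`,
`|log(1 + w)| ≤ (3∕2)|w|`). [cite: Balaban1987RG1, (1.18) p.263, p.268] -/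
theorem norm_jacFactorCt_sub_log_le (hj : j + 1 ≤ P.m + P.K) (W : PBond P j → MatA 2) (hW : ∀ b, (W b).det = 1) (c : PBond P (j + 1))
    (hpoly : ∀ i : Idx P, ‖loopMh W c i - 1‖ < 1 / 3)
    {α : ℝ} (hα0 : 0 ≤ α) (hα : α ≤ 1 / 24) (hloop : ∀ i, ¬ IsCentral c i → ‖loopMh W c i - 1‖ ≤ α)
    (hαr : 646 * α ≤ (nCentral c : ℝ) / (Fintype.card (Idx P) : ℝ) / 8) :
    ‖jacFactorCt c W - ((Real.log (((nCentral c : ℝ) / (Fintype.card (Idx P) : ℝ)) ^ 3) : ℝ) : ℂ)‖ ≤ 1 := by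
  haveI := nonempty_idxP (P := P)
  set r : ℝ := (nCentral c : ℝ) / (Fintype.card (Idx P) : ℝ) with hr
  have hr0 : 0 < r := div_pos (by exact_mod_cast BlockAveragingHaarAC.nCentral_pos c) (by exact_mod_cast Fintype.card_pos)
  have hr3 : 0 < r ^ 3 := pow_pos hr0 3
  have h := norm_det_jacBlockCt_sub_le hj W hW c hpoly hα0 hα hloop hαr
  set z := (jacBlockCt c W).det with hz
  set w : ℂ := z / (r : ℂ) ^ 3 - 1 with hw
  have hr3C : ((r : ℂ) ^ 3) ≠ 0 := by exact_mod_cast hr3.ne'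
  have hzw : z = ((r ^ 3 : ℝ) : ℂ) * (1 + w) := by
    rw [hw, Complex.ofReal_pow, add_sub_cancel, mul_div_cancel₀ _ hr3C]
  have hwn : ‖w‖ ≤ 1 / 2 := by
    have e : w = (z - (r : ℂ) ^ 3) / (r : ℂ) ^ 3 := by rw [hw, sub_div, div_self hr3C]
    rw [e, norm_div, norm_pow, Complex.norm_real, Real.norm_of_nonneg hr0.le, div_le_iff₀ hr3]
    linarith
  have hw1 : 1 + w ≠ 0 := by
    intro h0
    have : ‖w‖ = 1 := by rw [show w = -1 from eq_neg_of_add_eq_zero_right h0, norm_neg, norm_one]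
    linarith
  show ‖Complex.log z - ((Real.log (r ^ 3) : ℝ) : ℂ)‖ ≤ 1
  rw [hzw, Complex.log_ofReal_mul hr3 hw1, add_sub_cancel_left]
  exact (Complex.norm_log_one_add_half_le_self hwn).trans (by linarith)

end Summit.QuantumFields.YangMills.Theorems.BalabanUVNodesPortS1

end
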